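import Mathlib
import HarnessLib
import Summits.Ventures.LatticeQCDFlow.Exactness.SphereLOFlowLinks
import Summits.Ventures.LatticeQCDFlow.Exactness.SphereLuscherConstantsTorusTriangleFree

/-!
# The link-transported nearest-neighbour coupling of the periodic lattice `(ℤ/L)^ν`, `L ≥ 3`, inhabits ALL the structural hypotheses of the entropy floor: no self-coupling, nearest-neighbour support, scaled-isometric links (`β ∈ {0,1}`), local weight `Σ_m‖U_{nm}‖ ≤ 2ν`

HONEST FRAMING: exact (Metropolis-corrected) sampling algorithms for lattice gauge theory;
figures of merit are autocorrelation/cost numbers at stated couplings and volumes; no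
continuum-physics claim.

Venture `LatticeQCDFlow` (cell pub-lqcd), topic `Exactness`; FANOUT row 7 (`s0-cpn-null`: the
S0-D1 rung — 2D CP⁹ on periodic `L × L` lattices).  NEW WORK of the cell over the tree's
`Exactness/SphereLOFlowLinks.lean` (`linkCoupling src tgt R n m = Σ_{ℓ:n→m} R_ℓ⁻¹ + Σ_{ℓ:m→n} R_ℓ`,
`linkCoupling_apply`, `linkCoupling_self`, `inner_linkCoupling` — adjoint pairs) and the Literature
torus `Site ν L`, `Site.shift` (`Literature/MathematicalPhysics/QuantumFieldTheory/ConstructiveQFTWave0`,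
via `Exactness/SphereLuscherConstantsTorusTriangleFree`); nothing is cited as a fact.  Printed
counterpart, NAMED ONLY: Engel–Schaefer, Comput. Phys. Commun. 182 (2011) 2107, §2 eqs. (1), (6)–(7)
(the gauged CP(N−1) action on the periodic square lattice: `J_n = Σ_μ Λᵀ_{n,μ} x_{n+μ̂}`, `U(1)`
phases as transporters).  The point: the theorems of this lineage on the exact leading-order flow
sampler (ceilings GEN-16, floors GEN-17/18) carry hypotheses on an abstract coupling family `U` —
`U_{nn} = 0`, adjoint pairs, and (for the explicit floor) NEAREST-NEIGHBOUR SUPPORT, SCALED-ISOMETRIC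
LINKS `‖U_{nm}v‖ = β_{nm}‖v‖` and a local weight bound `Σ_m‖U_{nm}‖ ≤ υ`; here all of them are
discharged for the MODEL OF RECORD, the link coupling of the torus `(ℤ/L)^ν` with links
`(x, i) : x → x + e_i` carrying arbitrary linear isometries `R_{(x,i)}` (CP(N−1): `U(1)` phases on
`ℂ^N ≅ ℝ^{2N}`), for every `L ≥ 3` (so that `x + e_i ≠ x` and `x + e_i + e_j ≠ x`: the nearest-neighbour
graph is simple), with `β_{nm} = 1` on neighbours, `0` otherwise, and `υ = 2ν`.

## Content

* §1 `torus_single_one_ne_zero`, `torus_shift_ne_self`, `torus_shift_inj`, `torus_shift_shift_ne_self`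
  (`L ≥ 3`: unit steps are nonzero, determined by their direction, and two of them never cancel).
* §2 **`torusLink_self`** (`U_{nn} = 0`), **`torusLink_ne_zero_imp_nn`** (nearest-neighbour support),
  **`torusLink_apply_shift`** / **`torusLink_shift_apply`** (`U_{n,n+e_i} = R_{(n,i)}⁻¹`,
  `U_{m+e_i,m} = R_{(m,i)}`), **`norm_torusLink_apply`** (SCALED ISOMETRIES:
  `‖U_{nm}v‖ = [n ∼ m]·‖v‖`), **`sum_norm_torusLink_le`** (`Σ_m‖U_{nm}‖ ≤ 2ν`).

NOT CLAIMED: `L ∈ {1, 2}` (multiple links between the same sites); the link (`U(1)`) dynamics;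
anything quantitative beyond the displayed identities.
-/

noncomputable section

namespace Summit.Ventures.LatticeQCDFlow.Exactness

open Function Set Literature.MathematicalPhysics.QuantumFieldTheory
open scoped RealInnerProductSpace Classical

variable {ν L : ℕ}

/-! ## §1 Unit steps on `(ℤ/L)^ν`, `L ≥ 3` -/

section Steps

/-- For `L ≥ 2`, `(1 : ℤ/L) ≠ 0`; for `L ≥ 3`, also `(2 : ℤ/L) ≠ 0`. -/
theorem torus_one_two_ne_zero (hL : 3 ≤ L) : (1 : ZMod L) ≠ 0 ∧ (2 : ZMod L) ≠ 0 := by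
  constructor
  · intro h
    have h' : ((1 : ℕ) : ZMod L) = 0 := by exact_mod_cast h
    have := Nat.le_of_dvd Nat.one_pos ((ZMod.natCast_eq_zero_iff 1 L).mp h')
    omega
  · intro h
    have h' : ((2 : ℕ) : ZMod L) = 0 := by exact_mod_cast h
    have := Nat.le_of_dvd (by norm_num) ((ZMod.natCast_eq_zero_iff 2 L).mp h')
    omega

/-- A unit step moves: `x + e_i ≠ x` (`L ≥ 3`). -/
theorem torus_shift_ne_self (hL : 3 ≤ L) (x : Site ν L) (i : Fin ν) : x.shift i ≠ x := by
  intro h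
  have h1 : (Pi.single i (1 : ZMod L) : Site ν L) i = 0 := by
    have e : x + Pi.single i 1 = x + 0 := by rw [add_zero]; exact h
    rw [add_left_cancel e]; rfl
  rw [Pi.single_eq_same] at h1
  exact (torus_one_two_ne_zero hL).1 h1

/-- A unit step determines its direction: `x + e_i = x + e_j ⇒ i = j` (`L ≥ 3`). -/
theorem torus_shift_inj (hL : 3 ≤ L) (x : Site ν L) {i j : Fin ν} (h : x.shift i = x.shift j) : i = j := by
  by_contra hij
  have e : (Pi.single i (1 : ZMod L) : Site ν L) = Pi.single j 1 := add_left_cancel h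
  have h1 := congr_fun e i
  rw [Pi.single_eq_same, Pi.single_eq_of_ne hij] at h1
  exact (torus_one_two_ne_zero hL).1 h1

/-- Two unit steps never cancel: `x + e_i + e_j ≠ x` (`L ≥ 3`). -/
theorem torus_shift_shift_ne_self (hL : 3 ≤ L) (x : Site ν L) (i j : Fin ν) : (x.shift i).shift j ≠ x := by
  intro h
  have e : (Pi.single i (1 : ZMod L) : Site ν L) + Pi.single j 1 = 0 := by
    have h' : x + (Pi.single i 1 + Pi.single j 1) = x + 0 := by
      rw [add_zero, ← add_assoc]; exact h
    exact add_left_cancel h'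
  have h1 := congr_fun e i
  rw [Pi.add_apply, Pi.single_eq_same, Pi.zero_apply] at h1
  by_cases hji : j = i
  · subst hji
    rw [Pi.single_eq_same] at h1
    exact (torus_one_two_ne_zero hL).2 (by rw [← h1]; ring)
  · rw [Pi.single_eq_of_ne (Ne.symm hji), add_zero] at h1
    exact (torus_one_two_ne_zero hL).1 h1

end Steps

/-! ## §2 The torus link coupling inhabits the hypotheses -/

section Links

variable [NeZero L] {E : Type*} [NormedAddCommGroup E] [InnerProductSpace ℝ E]
  (R : Site ν L × Fin ν → (E ≃ₗᵢ[ℝ] E))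

/-- **No self-coupling** for the torus link coupling (`L ≥ 3`). -/
theorem torusLink_self (hL : 3 ≤ L) (n : Site ν L) :
    linkCoupling (fun ℓ : Site ν L × Fin ν => ℓ.1) (fun ℓ => ℓ.1.shift ℓ.2) R n n = 0 :=
  linkCoupling_self _ _ R (fun ℓ => (torus_shift_ne_self hL ℓ.1 ℓ.2).symm) n

/-- **Nearest-neighbour support**: `U_{nm} ≠ 0 ⇒ m = n + e_i` or `n = m + e_i` for some `i`. -/
theorem torusLink_ne_zero_imp_nn (n m : Site ν L)
    (h : linkCoupling (fun ℓ : Site ν L × Fin ν => ℓ.1) (fun ℓ => ℓ.1.shift ℓ.2) R n m ≠ 0) :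
    ∃ i : Fin ν, m = n.shift i ∨ n = m.shift i := by
  by_contra hne
  push Not at hne
  apply h
  ext v
  rw [linkCoupling_apply, zero_apply]
  refine Finset.sum_eq_zero fun ℓ _ => ?_
  have h1 : ¬ (ℓ.1 = n ∧ ℓ.1.shift ℓ.2 = m) := fun hc => (hne ℓ.2).1 (by rw [← hc.1]; exact hc.2.symm)
  have h2 : ¬ (ℓ.1 = m ∧ ℓ.1.shift ℓ.2 = n) := fun hc => (hne ℓ.2).2 (by rw [← hc.1]; exact hc.2.symm)
  rw [if_neg h1, if_neg h2, add_zero]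

/-- **The forward link**: `U_{n, n+e_i} v = R_{(n,i)}⁻¹ v` (`L ≥ 3`). -/
theorem torusLink_apply_shift (hL : 3 ≤ L) (n : Site ν L) (i : Fin ν) (v : E) :
    linkCoupling (fun ℓ : Site ν L × Fin ν => ℓ.1) (fun ℓ => ℓ.1.shift ℓ.2) R n (n.shift i) v =
      (R (n, i)).symm v := by
  rw [linkCoupling_apply, Finset.sum_eq_single (n, i)]
  · have h2 : ¬ ((n, i).1 = n.shift i ∧ (n, i).1.shift (n, i).2 = n) :=
      fun hc => torus_shift_ne_self hL n i hc.1.symm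
    rw [if_pos ⟨rfl, rfl⟩, if_neg h2, add_zero]
  · intro ℓ _ hℓ
    have h1 : ¬ (ℓ.1 = n ∧ ℓ.1.shift ℓ.2 = n.shift i) := by
      rintro ⟨h1, h2⟩
      apply hℓ
      have hi : ℓ.2 = i := torus_shift_inj hL n (by rw [← h1] at h2 ⊢; exact h2)
      exact Prod.ext h1 hi
    have h2 : ¬ (ℓ.1 = n.shift i ∧ ℓ.1.shift ℓ.2 = n) := by
      rintro ⟨h1, h2⟩
      rw [h1] at h2
      exact torus_shift_shift_ne_self hL n i ℓ.2 h2
    rw [if_neg h1, if_neg h2, add_zero]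
  · intro h; exact absurd (Finset.mem_univ _) h

/-- **The backward link**: `U_{m+e_i, m} v = R_{(m,i)} v` (`L ≥ 3`). -/
theorem torusLink_shift_apply (hL : 3 ≤ L) (m : Site ν L) (i : Fin ν) (v : E) :
    linkCoupling (fun ℓ : Site ν L × Fin ν => ℓ.1) (fun ℓ => ℓ.1.shift ℓ.2) R (m.shift i) m v =
      R (m, i) v := by
  rw [linkCoupling_apply, Finset.sum_eq_single (m, i)]
  · have h1 : ¬ ((m, i).1 = m.shift i ∧ (m, i).1.shift (m, i).2 = m) :=
      fun hc => torus_shift_ne_self hL m i hc.1.symm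
    rw [if_neg h1, if_pos ⟨rfl, rfl⟩, zero_add]
  · intro ℓ _ hℓ
    have h1 : ¬ (ℓ.1 = m.shift i ∧ ℓ.1.shift ℓ.2 = m) := by
      rintro ⟨h1, h2⟩
      rw [h1] at h2
      exact torus_shift_shift_ne_self hL m i ℓ.2 h2
    have h2 : ¬ (ℓ.1 = m ∧ ℓ.1.shift ℓ.2 = m.shift i) := by
      rintro ⟨h1, h2⟩
      apply hℓ
      have hi : ℓ.2 = i := torus_shift_inj hL m (by rw [← h1] at h2 ⊢; exact h2)
      exact Prod.ext h1 hi
    rw [if_neg h1, if_neg h2, add_zero]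
  · intro h; exact absurd (Finset.mem_univ _) h

/-- **SCALED-ISOMETRIC LINKS**: `‖U_{nm} v‖ = β_{nm}‖v‖` with `β_{nm} = 1` if `n, m` are nearest
neighbours and `0` otherwise (`L ≥ 3`). -/
theorem norm_torusLink_apply (hL : 3 ≤ L) (n m : Site ν L) (v : E) :
    ‖linkCoupling (fun ℓ : Site ν L × Fin ν => ℓ.1) (fun ℓ => ℓ.1.shift ℓ.2) R n m v‖ =
      (if ∃ i : Fin ν, m = n.shift i ∨ n = m.shift i then (1 : ℝ) else 0) * ‖v‖ := by
  by_cases h : ∃ i : Fin ν, m = n.shift i ∨ n = m.shift i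
  · rw [if_pos h, one_mul]
    obtain ⟨i, hm | hn⟩ := h
    · rw [hm, torusLink_apply_shift R hL, LinearIsometryEquiv.norm_map]
    · rw [hn, torusLink_shift_apply R hL, LinearIsometryEquiv.norm_map]
  · rw [if_neg h, zero_mul]
    have h0 : linkCoupling (fun ℓ : Site ν L × Fin ν => ℓ.1) (fun ℓ => ℓ.1.shift ℓ.2) R n m = 0 := by
      by_contra hne
      exact h (torusLink_ne_zero_imp_nn R n m hne)
    rw [h0, zero_apply, norm_zero]

/-- **The local weight bound**: `Σ_m ‖U_{nm}‖ ≤ 2ν` (each site has at most `2ν` neighbours and every link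
is an isometry; `L ≥ 3`). -/
theorem sum_norm_torusLink_le (hL : 3 ≤ L) (n : Site ν L) :
    ∑ m, ‖linkCoupling (fun ℓ : Site ν L × Fin ν => ℓ.1) (fun ℓ => ℓ.1.shift ℓ.2) R n m‖ ≤ 2 * ν := by
  have hop : ∀ m, ‖linkCoupling (fun ℓ : Site ν L × Fin ν => ℓ.1) (fun ℓ => ℓ.1.shift ℓ.2) R n m‖ ≤
      (if ∃ i : Fin ν, m = n.shift i ∨ n = m.shift i then (1 : ℝ) else 0) := fun m =>
    ContinuousLinearMap.opNorm_le_bound _ (by positivity) fun v => (norm_torusLink_apply R hL n m v).le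
  refine (Finset.sum_le_sum fun m _ => hop m).trans ?_
  rw [Finset.sum_boole]
  -- the neighbours of `n` are the image of `Fin ν × Bool` under `(i, b) ↦ n ± e_i`
  have hsub : Finset.univ.filter (fun m : Site ν L => ∃ i : Fin ν, m = n.shift i ∨ n = m.shift i) ⊆
      (Finset.univ : Finset (Fin ν × Bool)).image
        (fun p => if p.2 then n.shift p.1 else n - Pi.single p.1 1) := by
    intro m hm
    rw [Finset.mem_filter] at hm
    obtain ⟨i, h | h⟩ := hm.2
    · exact Finset.mem_image.2 ⟨(i, true), Finset.mem_univ _, by simp [h]⟩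
    · refine Finset.mem_image.2 ⟨(i, false), Finset.mem_univ _, ?_⟩
      simp [h, Site.shift]
  calc ((Finset.univ.filter (fun m : Site ν L => ∃ i : Fin ν, m = n.shift i ∨ n = m.shift i)).card : ℝ)
      ≤ ((Finset.univ : Finset (Fin ν × Bool)).image
          (fun p => if p.2 then n.shift p.1 else n - Pi.single p.1 1)).card := by
        exact_mod_cast Finset.card_le_card hsub
    _ ≤ (Fintype.card (Fin ν × Bool) : ℝ) := by exact_mod_cast Finset.card_image_le
    _ = 2 * ν := by rw [Fintype.card_prod, Fintype.card_fin, Fintype.card_bool]; push_cast; ring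

end Links

end Summit.Ventures.LatticeQCDFlow.Exactness

end
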